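import Summits.ValiantsHypothesis.ValiantsHypothesis.Theses.LangWeilTransfer
import Literature.Computability.AlgebraicComplexity.ArithCircuitSkeletonRename
import Literature.Computability.AlgebraicComplexity.StandardFamilies

/-!
# LangWeilTransfer, support item `UniversalGlue` (stmt-ValiantsHypothesis-6375) — PROVED

Route `LangWeilTransfer` of `ValiantsHypothesis`, support item `UniversalGlue`:
`UniversalTameness → ShatteringExclusion` ("instantiate `g = per_n`, `|P| ≤ n^c`; bookkeeping of
exponents"). The one non-trivial point: `UniversalTameness` speaks of circuits in the variables
`Fin n`, `ShatteringExclusion` of circuits for `per_n` in the variables `Fin n × Fin n`; the proof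
transports along `finProdFinEquiv : Fin n × Fin n ≃ Fin (n·n)` with the tree's `ArithCircuit.rename`
(size, fan-in, computed polynomial are preserved) and the cell's `skeleton_rename` /
`coeff_mapDomain_sumAlgEquiv_rename` (Bürgisser's integer skeleton commutes with renaming the
inputs), so that the coefficient ideal of the renamed circuit is the image of the original one under
the variable-renaming ring isomorphism `rename (finCongr _)` of the slot indeterminates — which
preserves minimal primes and, after base change to `ℚ̄`, their number. Exponents:
`c' = d₀ = (max c 2 + 2)·e`, `N = 2`, from `(n^c + n² + 2)^e ≤ n^{(max c 2 + 2) e}` for `n ≥ 2`.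
Honest framing: bookkeeping inside a dormant route; both glued statements are open problems;
nothing here bears on VP ≠ VNP.
-/

noncomputable section

open MvPolynomial

-- the summit and the problem share the name `ValiantsHypothesis` (D-0017 single-conjunct layout)
set_option linter.dupNamespace false

namespace Summit.ValiantsHypothesis.ValiantsHypothesis.Theorems.LangWeilTransfer

open Literature.Computability.AlgebraicComplexity

/-- Exponent bookkeeping: `(s + n·n + 2)^e ≤ n^{(max c 2 + 2) e}` for `s ≤ n^c`, `n ≥ 2`. -/
theorem pow_bound {n c s e : ℕ} (hn : 2 ≤ n) (hs : s ≤ n ^ c) :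
    (s + n * n + 2) ^ e ≤ n ^ ((max c 2 + 2) * e) := by
  have h1 : n ^ c ≤ n ^ max c 2 := Nat.pow_le_pow_right (by omega) (le_max_left _ _)
  have h2 : n * n ≤ n ^ max c 2 := by
    rw [← pow_two]; exact Nat.pow_le_pow_right (by omega) (le_max_right _ _)
  have h3 : 2 ≤ n ^ max c 2 :=
    hn.trans (by simpa using Nat.pow_le_pow_right (n := n) (by omega) (show 1 ≤ max c 2 by omega))
  have h4 : 3 ≤ n ^ 2 := by nlinarith
  have h5 : s + n * n + 2 ≤ n ^ (max c 2 + 2) := by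
    calc s + n * n + 2 ≤ 3 * n ^ max c 2 := by omega
      _ ≤ n ^ 2 * n ^ max c 2 := Nat.mul_le_mul_right _ h4
      _ = n ^ (max c 2 + 2) := by rw [← pow_add, add_comm]
  calc (s + n * n + 2) ^ e ≤ (n ^ (max c 2 + 2)) ^ e := Nat.pow_le_pow_left h5 e
    _ = n ^ ((max c 2 + 2) * e) := by rw [← pow_mul]

/-- Minimal primes and their number after base change are invariant under renaming the (slot)
variables along a bijection `Fin m ≃ Fin m'` (transport of structure). -/
theorem minimalPrimes_transport {m m' : ℕ} (h : m = m') (I 𝔭 : Ideal (MvPolynomial (Fin m) ℚ))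
    (h𝔭 : 𝔭 ∈ I.minimalPrimes) :
    Ideal.map (rename (Fin.cast h) : MvPolynomial (Fin m) ℚ →ₐ[ℚ] MvPolynomial (Fin m') ℚ) 𝔭 ∈
        (Ideal.map (rename (Fin.cast h) : MvPolynomial (Fin m) ℚ →ₐ[ℚ] MvPolynomial (Fin m') ℚ) I).minimalPrimes ∧
      ((Ideal.map (MvPolynomial.map (algebraMap ℚ (AlgebraicClosure ℚ)))
          (Ideal.map (rename (Fin.cast h) : MvPolynomial (Fin m) ℚ →ₐ[ℚ] MvPolynomial (Fin m') ℚ) 𝔭)).minimalPrimes).ncard =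
        ((Ideal.map (MvPolynomial.map (algebraMap ℚ (AlgebraicClosure ℚ))) 𝔭).minimalPrimes).ncard := by
  subst h
  have hid : (rename (Fin.cast (rfl : m = m)) : MvPolynomial (Fin m) ℚ →ₐ[ℚ] MvPolynomial (Fin m) ℚ) =
      AlgHom.id ℚ _ := by
    refine MvPolynomial.algHom_ext fun i => ?_
    simp
  have hmap : ∀ J : Ideal (MvPolynomial (Fin m) ℚ),
      Ideal.map (AlgHom.id ℚ (MvPolynomial (Fin m) ℚ)) J = J := fun J =>
    le_antisymm (Ideal.map_le_iff_le_comap.mpr fun x hx => by simpa using hx)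
      fun x hx => by simpa using Ideal.mem_map_of_mem (AlgHom.id ℚ (MvPolynomial (Fin m) ℚ)) hx
  rw [hid, hmap, hmap]
  exact ⟨h𝔭, rfl⟩

/-- **Support item `UniversalGlue` (stmt-ValiantsHypothesis-6375)**: Galois tameness of algebraic
computation (`UniversalTameness`) implies the permanent's shattering exclusion
(`ShatteringExclusion`): instantiate at `g = per_n` transported to the variables `Fin (n·n)`,
rename back, and track exponents. -/
theorem universalGlue_proof :
    Summit.ValiantsHypothesis.ValiantsHypothesis.Theses.LangWeilTransfer.UniversalGlue := by
  intro hUT c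
  obtain ⟨E, hE⟩ := hUT
  refine ⟨(max c 2 + 2) * E, (max c 2 + 2) * E, 2, fun n hn hP => ?_⟩
  obtain ⟨P₀, hP₀fan, hP₀size, hP₀comp⟩ := hP
  set e : Fin n × Fin n ≃ Fin (n * n) := finProdFinEquiv with he
  set g : MvPolynomial (Fin (n * n)) ℤ := rename e (perPoly (Fin n) ℤ) with hg
  -- the renamed circuit computes the renamed permanent
  have hP₁comp : (P₀.rename e).Computes (MvPolynomial.map (Int.castRingHom ℂ) g) := by
    have h := hP₀comp.rename e
    rwa [← map_perPoly (Int.castRingHom ℂ) (n := Fin n), ← MvPolynomial.map_rename] at h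
  obtain ⟨P₁, hfan, hsize, hcomp, I₁, hI₁, 𝔭₁, h𝔭₁, hpos, hle⟩ :=
    hE (n * n) g (P₀.rename e) (hP₀fan.rename e) hP₁comp
  rw [ArithCircuit.size_rename] at hsize hle
  -- rename back
  have hper : rename e.symm g = perPoly (Fin n) ℤ := by
    rw [hg, rename_rename, e.symm_comp_self, rename_id, AlgHom.id_apply]
  refine ⟨P₁.rename e.symm, hfan.rename _, ?_, ?_, ?_⟩
  · rw [ArithCircuit.size_rename]
    exact hsize.trans (pow_bound hn hP₀size)
  · have h := hcomp.rename e.symm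
    rwa [← MvPolynomial.map_rename, hper, map_perPoly] at h
  -- the coefficient ideal of the renamed circuit is the renamed coefficient ideal
  have hsz : 4 * P₁.size + 1 = 4 * (P₁.rename e.symm).size + 1 := by rw [ArithCircuit.size_rename]
  set Φ : MvPolynomial (Fin (4 * P₁.size + 1)) ℚ →ₐ[ℚ] MvPolynomial (Fin (4 * (P₁.rename e.symm).size + 1)) ℚ :=
    rename (Fin.cast hsz) with hΦ
  set gen₁ : (Fin (n * n) →₀ ℕ) → MvPolynomial (Fin (4 * P₁.size + 1)) ℚ := fun α =>
    MvPolynomial.map (Int.castRingHom ℚ)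
      (MvPolynomial.coeff α (MvPolynomial.sumAlgEquiv ℤ (Fin (n * n)) (Fin (4 * P₁.size + 1))
        (skeleton P₁).eval) - MvPolynomial.C (MvPolynomial.coeff α g)) with hgen₁
  set gen₂ : ((Fin n × Fin n) →₀ ℕ) → MvPolynomial (Fin (4 * (P₁.rename e.symm).size + 1)) ℚ :=
    fun β => MvPolynomial.map (Int.castRingHom ℚ)
      (MvPolynomial.coeff β (MvPolynomial.sumAlgEquiv ℤ (Fin n × Fin n) (Fin (4 * (P₁.rename e.symm).size + 1))
        (skeleton (P₁.rename e.symm)).eval) -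
        MvPolynomial.C (MvPolynomial.coeff β (perPoly (Fin n) ℤ))) with hgen₂
  have hgen : ∀ α, gen₂ (Finsupp.mapDomain e.symm α) = Φ (gen₁ α) := by
    intro α
    simp only [hgen₂, hgen₁, hΦ]
    rw [eval_skeleton_rename, coeff_mapDomain_sumAlgEquiv_rename e.symm.injective, ← hper,
      coeff_rename_mapDomain _ e.symm.injective, map_sub, map_sub, map_sub, map_C, map_C,
      rename_C, MvPolynomial.map_rename]
  have hrange : Set.range gen₂ = ⇑Φ '' Set.range gen₁ := by
    rw [← Set.range_comp]
    have hsurj : Function.Surjective (Finsupp.mapDomain e.symm : (Fin (n * n) →₀ ℕ) → ((Fin n × Fin n) →₀ ℕ)) := by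
      intro β
      refine ⟨Finsupp.mapDomain e β, ?_⟩
      rw [← Finsupp.mapDomain_comp, e.symm_comp_self, Finsupp.mapDomain_id]
    rw [← hsurj.range_comp]
    exact congrArg Set.range (funext hgen)
  have hI₂ : Ideal.span (Set.range gen₂) = Ideal.map Φ I₁ := by
    rw [hI₁, Ideal.map_span, hrange]
  obtain ⟨hmin, hcard⟩ := minimalPrimes_transport hsz I₁ 𝔭₁ h𝔭₁
  refine ⟨Ideal.span (Set.range gen₂), rfl, Ideal.map Φ 𝔭₁, ?_, ?_, ?_⟩
  · rw [hI₂]; exact hmin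
  · rw [hcard]; exact hpos
  · rw [hcard]; exact hle.trans (pow_bound hn hP₀size)

end Summit.ValiantsHypothesis.ValiantsHypothesis.Theorems.LangWeilTransfer
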